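/- Copyright: the b2b-balaban cell (near-miss cell 7), T⁴-continuum fan-out, NE7b swarm leaf 04 (gen 5; road W-RP-VAR,
supplier «W3d»: W3b's structural hypotheses for DETERMINISTIC (δ-function) block-average kernels).  Released under the
licence of the surrounding project. -/
import Summits.QuantumFields.BalabanUV.T4Continuum.Support.HistoryRPExtension

/-!
# History chessboard road: the RP-extension step for δ-FUNCTION (pushforward) block averages

Summits-side support leaf of the T⁴-continuum cell (rung (B)+1 on a FINITE torus only; NOT infinite volume, NOT the
mass gap, NOT the Clay statement; NOT a proof of the spine estimate NE7b).  Road W-RP-VAR of the swarm claim table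
`t4/b2b-balaban-t4-ne7b-p1/LEAVES-NE7b.md` (owner ruling R-OWNER-23-2), supplier «W3d» (journal INTENT of leaf-04 g5)
beside W3b (`HistoryRPExtension`) and W3c (`HistoryRPBase`).  [folklore] Mathlib bookkeeping; imports W3b only; no
`def`, no `structure`, no `[cite:]` tag, nothing printed asserted, no Bałaban object instantiated.

WHY.  Row W3 (`HistoryRPTensor`) records that the block average of [B12] (13) is a δ-FUNCTION — a pushforward, NOT a
density — so the block-bond variables of a level enter the extended state through a DETERMINISTIC Markov kernel
`Kernel.deterministic f` of the block-average map `f` (the Gaussian-normalised averaging variants are genuinely random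
kernels and stay with the general W3b).  For deterministic kernels the two structural hypotheses of W3b's level step
`HistoryRPExtension.rpPackage_level` are sentences about FUNCTIONS:
* (i) «the positive-half kernel reads positive-half data», `Measurable[mP] ⇑κ` ⇐ `Measurable[mP] f`
  (`measurable_deterministic_of_measurable`): the positive-half block averages are functions of the positive-half
  fine variables;
* (iii) «the crossing kernel is covariant», `η (θ' p) = (η p).map τ` ⇐ `g (θ' p) = τ (g p)`
  (`deterministic_covariant_of_semiconj`): the crossing averages intertwine the reflections;
and (ii) «the negative-half kernel is the θ-transport of the positive one» is by construction (`κ.comap θ`).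

WHAT.  §1 the two reductions; §2 **`rpPackage_level_deterministic`** = W3b's `rpPackage_level` at
`κ := Kernel.deterministic f`, `η := Kernel.deterministic g`: RP-package in ⇒ RP-package out for the δ-extended state
`(μ ⊗ₘ (δ_f ×ₖ δ_f.comap θ)) ⊗ₘ δ_g`; §3 sanity: an inhabited instance (identity averages over a one-point base) and
the owner's DECIDED TOY (booking l.14340): in a two-block cartoon (`Fin 6`, blocks of odd side 3, δ-average = «read the
variable at the block's base point») the CENTRED base point gives a reflection-EQUIVARIANT average map and the printed
LOWEST-CORNER base point does NOT (`decide`) — census-grade evidence for the located negative (11c) ∕ memo F1.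

HONEST.  The two function-level sentences remain DISPLAYED hypotheses about the CENTRED prescription's average maps
((VAR)-shaped; TRUE∕FALSE per prescription exactly as memo `IDEAS-NE7-g27.md` F1 ∕ `t4/T4-EST-NE7b-P1.md` (11c) say);
this file instantiates nothing, mints no `Prop` fact (c1), touches no constant (c2∕c6) and no exit ∕ socket ∕
`HistoryConstants` file (c3).  NE7b NOT proved; spine 0∕9.  HONEST DEPENDENCY (cell): continuum YM on T⁴ ⇐ BetaPertH ∧
nine spine estimates (0/9 proved); BetaPertH ⇐ (D1) ∧ (D4) ∧ CAP+tail; G-an2-4 gates asym, D1 and NE2/3/4.  This file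
changes none of it. -/

open MeasureTheory ProbabilityTheory
open Literature.MathematicalPhysics.QuantumFieldTheory.LatticeRP (IsReflectionPositiveBdd)

namespace Summit.QuantumFields.BalabanUV.T4Continuum.HistoryRPDeterministic

noncomputable section

/-! ## §1 The two structural hypotheses of W3b for deterministic kernels -/

section Reductions

variable {Ω Y : Type*} {mP : MeasurableSpace Ω} [m : MeasurableSpace Ω] [mY : MeasurableSpace Y]

/-- **(i) FOR A δ-KERNEL.**  If the block-average map `f` is measurable for the positive σ-algebra `mP`, then the
deterministic kernel `Kernel.deterministic f` reads positive-half data in W3b's sense: it is `mP`-measurable as a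
measure-valued map (`measurable_dirac ∘ f`). [folklore] -/
theorem measurable_deterministic_of_measurable {f : Ω → Y} (hf : Measurable f) (hfP : Measurable[mP] f) :
    Measurable[mP] (⇑(Kernel.deterministic f hf) : Ω → Measure Y) := by
  have hcoe : (⇑(Kernel.deterministic f hf) : Ω → Measure Y) = fun a => Measure.dirac (f a) :=
    funext fun a => Kernel.deterministic_apply hf a
  rw [hcoe]
  exact Measure.measurable_dirac.comp hfP

omit mY in
/-- **(iii) FOR A δ-KERNEL.**  If the crossing-average map `g` INTERTWINES the reflections, `g (θ' p) = τ (g p)`, then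
the deterministic kernel `Kernel.deterministic g` is covariant in W3b's sense: `δ_{g (θ' p)} = (δ_{g p}).map τ`
(`Measure.map_dirac'`). [folklore] -/
theorem deterministic_covariant_of_semiconj {Z : Type*} [MeasurableSpace Z] {θ' : Ω → Ω} {g : Ω → Z}
    (hg : Measurable g) {τ : Z → Z} (hτ : Measurable τ) (hsemi : ∀ p, g (θ' p) = τ (g p)) (p : Ω) :
    Kernel.deterministic g hg (θ' p) = ((Kernel.deterministic g hg) p).map τ := by
  rw [Kernel.deterministic_apply, Kernel.deterministic_apply, hsemi, Measure.map_dirac' hτ]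

end Reductions

/-! ## §2 One level of the extended state with δ-function block averages -/

section Level

variable {Ω Y Z : Type*} {mP : MeasurableSpace Ω} [m : MeasurableSpace Ω] [mY : MeasurableSpace Y]
  [mZ : MeasurableSpace Z]

/-- **ONE LEVEL WITH δ-FUNCTION AVERAGES, relative to one block hyperplane** (W3b's `rpPackage_level` at deterministic
kernels).  Inputs: the previous level's RP-package `(hm, hθm, hθ, hθθ, hRP)`; the positive-half block-average MAP
`f : Ω → Y`, measurable and `mP`-measurable («reads positive-half fine variables»; the negative-half averages are
`f ∘ θ` BY CONSTRUCTION — the centred prescription's covariance); the crossing-average MAP `g` on the pair-extended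
space, measurable and intertwining the pair-extended reflection with a measurable involution `τ` of the crossing
variables.  Output: the RP-package of the δ-extended state
`((μ ⊗ₘ (δ_f ×ₖ δ_f.comap θ)) ⊗ₘ δ_g, positive σ-algebra of (ω, y₊) pulled back, ((ω,y₊,y₋),z) ↦ ((θω,y₋,y₊), τ z))`.
[folklore] -/
theorem rpPackage_level_deterministic (hm : mP ≤ m) {μ : Measure Ω} [IsFiniteMeasure μ]
    {θ : Ω → Ω} (hθm : Measurable θ) (hθ : MeasurePreserving θ μ μ) (hθθ : θ ∘ θ = id)
    (hRP : IsReflectionPositiveBdd μ mP θ) {f : Ω → Y} (hf : Measurable f) (hfP : Measurable[mP] f)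
    {g : Ω × (Y × Y) → Z} (hg : Measurable g) {τ : Z → Z} (hτ : Measurable τ) (hττ : τ ∘ τ = id)
    (hsemi : ∀ p : Ω × (Y × Y), g (θ p.1, p.2.swap) = τ (g p)) :
    ((mP.prod mY).comap (fun p : Ω × (Y × Y) => (p.1, p.2.1))).comap
          (Prod.fst : (Ω × (Y × Y)) × Z → Ω × (Y × Y)) ≤ (m.prod (mY.prod mY)).prod mZ ∧
      Measurable (fun q : (Ω × (Y × Y)) × Z => ((θ q.1.1, q.1.2.swap), τ q.2)) ∧
      MeasurePreserving (fun q : (Ω × (Y × Y)) × Z => ((θ q.1.1, q.1.2.swap), τ q.2))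
        ((μ ⊗ₘ ((Kernel.deterministic f hf) ×ₖ (Kernel.deterministic f hf).comap θ hθm)) ⊗ₘ
          Kernel.deterministic g hg)
        ((μ ⊗ₘ ((Kernel.deterministic f hf) ×ₖ (Kernel.deterministic f hf).comap θ hθm)) ⊗ₘ
          Kernel.deterministic g hg) ∧
      ((fun q : (Ω × (Y × Y)) × Z => ((θ q.1.1, q.1.2.swap), τ q.2)) ∘
          fun q : (Ω × (Y × Y)) × Z => ((θ q.1.1, q.1.2.swap), τ q.2)) = id ∧
      IsReflectionPositiveBdd
        ((μ ⊗ₘ ((Kernel.deterministic f hf) ×ₖ (Kernel.deterministic f hf).comap θ hθm)) ⊗ₘ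
          Kernel.deterministic g hg)
        (((mP.prod mY).comap (fun p : Ω × (Y × Y) => (p.1, p.2.1))).comap
          (Prod.fst : (Ω × (Y × Y)) × Z → Ω × (Y × Y)))
        (fun q : (Ω × (Y × Y)) × Z => ((θ q.1.1, q.1.2.swap), τ q.2)) :=
  HistoryRPExtension.rpPackage_level hm hθm hθ hθθ hRP (Kernel.deterministic f hf)
    (measurable_deterministic_of_measurable hf hfP) (Kernel.deterministic g hg) hτ hττ
    (deterministic_covariant_of_semiconj hg hτ hsemi)

/-- For the record: with δ-function averages the reflected pair of one level is itself a δ-kernel — the new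
coordinates are the FUNCTIONS `(f ω, f (θ ω))` of the old ones (`Kernel.prod_apply`, `Kernel.comap_apply`,
`Measure.dirac_prod_dirac`), so the extended state is a graph pushforward of the previous one. [folklore] -/
theorem pairKernel_deterministic {θ : Ω → Ω} (hθm : Measurable θ) {f : Ω → Y} (hf : Measurable f) :
    (Kernel.deterministic f hf) ×ₖ (Kernel.deterministic f hf).comap θ hθm =
      Kernel.deterministic (fun ω => (f ω, f (θ ω))) (hf.prodMk (hf.comp hθm)) := by
  ext ω s hs
  rw [Kernel.prod_apply, Kernel.comap_apply, Kernel.deterministic_apply, Kernel.deterministic_apply,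
    Kernel.deterministic_apply, Measure.dirac_prod_dirac]

end Level

/-! ## §3 Sanity: identity averages over a reflection-positive base -/

section Sanity

/-- The hypotheses of §2 are INHABITED: over the one-point base (Dirac state, identity reflection, trivially
reflection positive) with identity block averages and a constant crossing average, §2 applies. [folklore] -/
example : IsReflectionPositiveBdd
    (((Measure.dirac () : Measure Unit) ⊗ₘ
        ((Kernel.deterministic (id : Unit → Unit) measurable_id) ×ₖ
          (Kernel.deterministic (id : Unit → Unit) measurable_id).comap id measurable_id)) ⊗ₘ
      Kernel.deterministic (fun _ : Unit × (Unit × Unit) => ()) measurable_const)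
    (((PUnit.instMeasurableSpace.prod PUnit.instMeasurableSpace).comap
        (fun p : Unit × (Unit × Unit) => (p.1, p.2.1))).comap Prod.fst)
    (fun q : (Unit × (Unit × Unit)) × Unit => ((id q.1.1, q.1.2.swap), id q.2)) := by
  refine (rpPackage_level_deterministic (mP := PUnit.instMeasurableSpace) le_rfl measurable_id
    (MeasurePreserving.id _) (funext fun _ => rfl) ?_ measurable_id measurable_id measurable_const measurable_id
    (funext fun _ => rfl) (fun _ => rfl)).2.2.2.2
  intro g _ _
  show 0 ≤ ∫ ω, g (id ω) * g ω ∂(Measure.dirac ())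
  rw [integral_dirac]
  exact mul_self_nonneg _

/-- **DECIDED TOY for the owner's census (booking l.14340): CENTRED base point ⇒ EQUIVARIANT.**  One dimension, six
sites `Fin 6`, two blocks of odd side `3`, the site reflection `x ↦ 5 - x` in the hyperplane between the blocks, the
block reflection `j ↦ 1 - j` on `Fin 2`, and the simplest δ-average «read the fine variable at the block's base
point».  With the CENTRED base points `![1, 4]` the average map intertwines the two reflections — the shape of W3b's
hypotheses (ii)∕(iii) («`avg ∘ θ = τ ∘ avg`») — for EVERY configuration (checked by `decide` over `Fin 6 → Bool`). -/
example : ∀ U : Fin 6 → Bool,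
    (fun j : Fin 2 => U (5 - (![1, 4] : Fin 2 → Fin 6) j)) = fun j => U ((![1, 4] : Fin 2 → Fin 6) (1 - j)) := by
  decide

/-- **DECIDED TOY: printed LOWEST-CORNER base point ⇒ NOT EQUIVARIANT.**  Same cartoon with the lowest-corner base
points `![0, 3]`: the intertwining FAILS (a configuration separating the sites `5` and `3` is a witness, found by
`decide`) — the two-block cartoon of the located negative for the printed corner prescription (memo F1 ∕ (11c)):
reflections carry lowest corners to highest corners, so the corner-based average is not reflection-related. -/
example : ¬ ∀ U : Fin 6 → Bool,
    (fun j : Fin 2 => U (5 - (![0, 3] : Fin 2 → Fin 6) j)) = fun j => U ((![0, 3] : Fin 2 → Fin 6) (1 - j)) := by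
  decide

end Sanity

end

end Summit.QuantumFields.BalabanUV.T4Continuum.HistoryRPDeterministic
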